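import Mathlib
import Literature.Analysis.FluidPDE.GaussianVortexPlanar
import Literature.Analysis.FluidPDE.PineauVicolWeightedIdentity
import Summits.AnomalousDissipation.AnomalousDissipation.Theorems.MarginalStabilityChainStretchedVortexRowsStubLogPotentialTools
import Summits.AnomalousDissipation.AnomalousDissipation.Theorems.MarginalStabilityChainStretchedVortexRowsStubLogPotentialGradient
import Summits.AnomalousDissipation.AnomalousDissipation.Theorems.MarginalStabilityChainStretchedVortexRowsStubLogPotentialGreen
import Summits.AnomalousDissipation.AnomalousDissipation.Theorems.MarginalStabilityChainStretchedVortexRowsStubLogPotentialNeutralBounded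
import Summits.AnomalousDissipation.AnomalousDissipation.Theorems.MarginalStabilityChainStretchedVortexRowsStubCellStreamSqrtPotential
import Summits.AnomalousDissipation.AnomalousDissipation.Theorems.MarginalStabilityChainStretchedVortexRowsStubCellStreamClassInvariance
import Summits.AnomalousDissipation.AnomalousDissipation.Theorems.MarginalStabilityChainStretchedVortexRowsStubCellSolvabilityRadialWeights
import HarnessLib

/-!
# The `C¹` representation `Ψ = N ∗ (F − VΨ)` of the solution of the integral equation
# (stub `cellStream_representation`, crux stmt-AnomalousDissipation-3009, line `braid-closed-large-circulation-gluing`)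

Step between the Lax–Milgram solution `h ∈ L²(ℝ²)` of `h + q · N∗(q h) = q · N∗F` (a.e.;
`…StubCellStreamL2Solvability`) and the smooth stream function: with `U = N∗(q h)` and `Ψ := N∗F − U`,
the a.e. equation gives `qΨ = h` a.e., hence `U = N∗(VΨ)` EVERYWHERE (equal integrands a.e.), where
`VΨ` is a bounded measurable density with Gaussian decay (the datum `F` and `U` have logarithmic growth);
the derivative-gain lemma for such densities (`logPotential_gain`, taken here as a hypothesis) makes `U`, hence
`Ψ`, of class `C¹` with bounded gradient, and then `g := F − VΨ ∈ C¹` has Gaussian bounds on `g`, `Dg`, with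
`Ψ = N ∗ g` pointwise. Everything downstream (weak Poisson, elliptic regularity, Biot–Savart) uses only this
`C¹` package. References: Gallay–Wayne, J. Math. Fluid Mech. 9 (2007) §3. [GallayWayne2006]
-/

set_option linter.dupNamespace false

noncomputable section

open scoped BigOperators Topology RealInnerProductSpace ContDiff
open Filter Set Function MeasureTheory WithLp

namespace Summit.AnomalousDissipation.AnomalousDissipation.Theorems.MarginalStabilityChainStretchedVortexRows

open Literature.Analysis.FluidPDE

/-! ### Small real-variable facts -/

/-- `V = q² ≤ (1 + ‖ξ‖)² e^{−‖ξ‖²/4}`. [folklore] -/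
theorem repr_V_le (ξ : EuclideanSpace ℝ (Fin 2)) :
    (4 * Real.pi * gaussVortexProfile ξ / burgersPhi (‖ξ‖ ^ 2 / 4)) ≤ (1 + ‖ξ‖) ^ 2 * Real.exp (-(1 / 4) * ‖ξ‖ ^ 2) := by
  obtain ⟨-, hqpos, hqsq, -, hqup, -, -⟩ := cellStream_sqrtPotential
  rw [← hqsq ξ]
  have h1 := hqup ξ
  have h0 := (hqpos ξ).le
  have e : ((1 + ‖ξ‖) * Real.exp (-(1 / 8) * ‖ξ‖ ^ 2)) ^ 2 = (1 + ‖ξ‖) ^ 2 * Real.exp (-(1 / 4) * ‖ξ‖ ^ 2) := by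
    rw [mul_pow, ← Real.exp_nat_mul]; congr 1; congr 1; push_cast; ring
  rw [← e]
  exact pow_le_pow_left₀ h0 h1 2

/-- `0 ≤ V`. [folklore] -/
theorem repr_V_nonneg (ξ : EuclideanSpace ℝ (Fin 2)) : 0 ≤ (4 * Real.pi * gaussVortexProfile ξ / burgersPhi (‖ξ‖ ^ 2 / 4)) := by
  have := gaussVortexProfile_pos ξ
  have := burgersPhi_pos (‖ξ‖ ^ 2 / 4)
  positivity

/-- `‖DV(ξ)‖ ≤ 2 (1 + ‖ξ‖)³ e^{−‖ξ‖²/4}` (from the tree's `|V| + ‖∇V‖ ≤ 8π(1+‖ξ‖)³G`). [folklore] -/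
theorem repr_norm_fderiv_V_le (ξ : EuclideanSpace ℝ (Fin 2)) :
    ‖fderiv ℝ (fun ξ : EuclideanSpace ℝ (Fin 2) => (4 * Real.pi * gaussVortexProfile ξ / burgersPhi (‖ξ‖ ^ 2 / 4))) ξ‖ ≤ 2 * (1 + ‖ξ‖) ^ 3 * Real.exp (-(1 / 4) * ‖ξ‖ ^ 2) := by
  obtain ⟨-, -, -, hVbd, -⟩ := stub_cellSolvability_radialWeights
  have h := hVbd ξ
  have hG : 8 * Real.pi * (1 + ‖ξ‖) ^ 3 * gaussVortexProfile ξ = 2 * (1 + ‖ξ‖) ^ 3 * Real.exp (-(1 / 4) * ‖ξ‖ ^ 2) := by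
    rw [gaussVortexProfile]
    have e : -(‖ξ‖ ^ 2 / 4) = -(1 / 4) * ‖ξ‖ ^ 2 := by ring
    rw [e]; field_simp; ring
  have key : ‖gradient (fun ξ : EuclideanSpace ℝ (Fin 2) => (4 * Real.pi * gaussVortexProfile ξ / burgersPhi (‖ξ‖ ^ 2 / 4))) ξ‖ =
      ‖fderiv ℝ (fun ξ : EuclideanSpace ℝ (Fin 2) => (4 * Real.pi * gaussVortexProfile ξ / burgersPhi (‖ξ‖ ^ 2 / 4))) ξ‖ := by
    rw [gradient, LinearIsometryEquiv.norm_map]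
  rw [← key]
  linarith [abs_nonneg ((4 * Real.pi * gaussVortexProfile ξ / burgersPhi (‖ξ‖ ^ 2 / 4)))]

/-- `1 + log(1 + t) ≤ 1 + t` for `t ≥ 0`. [folklore] -/
theorem repr_one_add_log_le {t : ℝ} (ht : 0 ≤ t) : 1 + Real.log (1 + t) ≤ 1 + t := by
  have := Real.log_le_sub_one_of_pos (by positivity : (0:ℝ) < 1 + t)
  linarith

/-- Polynomial–Gaussian absorption: `(1 + t)ᴺ e^{−t²/4} ≤ K_N e^{−t²/8}` (`t ≥ 0`). [folklore] -/
theorem repr_absorb (N : ℕ) : ∃ K : ℝ, 0 ≤ K ∧ ∀ t : ℝ, 0 ≤ t →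
    (1 + t) ^ N * Real.exp (-(1 / 4) * t ^ 2) ≤ K * Real.exp (-(1 / 8) * t ^ 2) := by
  refine ⟨N.factorial * (4 / (1 / 4)) ^ N * Real.exp ((1 / 4) / 2), by positivity, fun t ht => ?_⟩
  have h := PineauVicol2026.one_add_pow_mul_exp_neg_mul_sq_le (c := 1 / 4) (by norm_num) N ht
  have e : -((1 / 4 : ℝ) / 2) * t ^ 2 = -(1 / 8) * t ^ 2 := by ring
  rwa [e] at h

/-- The `C¹` Gaussian class of `g = F − VΨ` from the growth/gradient bounds of `Ψ`. [folklore] -/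
theorem repr_gclass {BF A D B₁ : ℝ} {F Ψ : EuclideanSpace ℝ (Fin 2) → ℝ} (hF : ContDiff ℝ 1 F)
    (hF0 : ∀ η, |F η| ≤ BF * Real.exp (-(1 / 8) * ‖η‖ ^ 2))
    (hF1 : ∀ η, ‖fderiv ℝ F η‖ ≤ BF * Real.exp (-(1 / 8) * ‖η‖ ^ 2))
    (hΨC1 : ContDiff ℝ 1 Ψ) (hA : 0 ≤ A) (hD0 : 0 ≤ D) (hB₁ : 0 ≤ B₁)
    (hΨbd : ∀ ξ, |Ψ ξ| ≤ A * (1 + Real.log (1 + ‖ξ‖)))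
    (hΨD : ∀ ξ, ‖fderiv ℝ Ψ ξ‖ ≤ D)
    (hg0bd : ∀ η : EuclideanSpace ℝ (Fin 2), |(4 * Real.pi * gaussVortexProfile η / burgersPhi (‖η‖ ^ 2 / 4)) * Ψ η| ≤ B₁ * Real.exp (-(1 / 8) * ‖η‖ ^ 2)) :
    ∃ B₂ : ℝ, ContDiff ℝ 1 (fun ξ => F ξ - (4 * Real.pi * gaussVortexProfile ξ / burgersPhi (‖ξ‖ ^ 2 / 4)) * Ψ ξ) ∧
      (∀ ξ, |F ξ - (4 * Real.pi * gaussVortexProfile ξ / burgersPhi (‖ξ‖ ^ 2 / 4)) * Ψ ξ| ≤ B₂ * Real.exp (-(1 / 8) * ‖ξ‖ ^ 2)) ∧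
      (∀ ξ, ‖fderiv ℝ (fun ξ => F ξ - (4 * Real.pi * gaussVortexProfile ξ / burgersPhi (‖ξ‖ ^ 2 / 4)) * Ψ ξ) ξ‖ ≤ B₂ * Real.exp (-(1 / 8) * ‖ξ‖ ^ 2)) := by
  obtain ⟨-, hVC, -, -, -⟩ := stub_cellSolvability_radialWeights
  obtain ⟨K₄, hK₄0, hK₄⟩ := repr_absorb 4
  have hVΨC1 : ContDiff ℝ 1 (fun ξ : EuclideanSpace ℝ (Fin 2) => (4 * Real.pi * gaussVortexProfile ξ / burgersPhi (‖ξ‖ ^ 2 / 4)) * Ψ ξ) :=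
    (hVC.of_le (by exact_mod_cast le_top)).mul hΨC1
  refine ⟨BF + B₁ + (D + 2 * A) * K₄, hF.sub hVΨC1, fun ξ => ?_, fun ξ => ?_⟩
  · have h1 := hF0 ξ
    have h2 := hg0bd ξ
    have h3 := abs_sub (F ξ) ((4 * Real.pi * gaussVortexProfile ξ / burgersPhi (‖ξ‖ ^ 2 / 4)) * Ψ ξ)
    have e0 : 0 ≤ Real.exp (-(1 / 8) * ‖ξ‖ ^ 2) := (Real.exp_pos _).le
    have h4 : 0 ≤ (D + 2 * A) * K₄ * Real.exp (-(1 / 8) * ‖ξ‖ ^ 2) := by positivity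
    calc |F ξ - (4 * Real.pi * gaussVortexProfile ξ / burgersPhi (‖ξ‖ ^ 2 / 4)) * Ψ ξ| ≤ |F ξ| + |(4 * Real.pi * gaussVortexProfile ξ / burgersPhi (‖ξ‖ ^ 2 / 4)) * Ψ ξ| := h3
      _ ≤ BF * Real.exp (-(1 / 8) * ‖ξ‖ ^ 2) + B₁ * Real.exp (-(1 / 8) * ‖ξ‖ ^ 2) := add_le_add h1 h2
      _ ≤ _ := by nlinarith
  · have hdF : DifferentiableAt ℝ F ξ := (hF.differentiable one_ne_zero) ξ
    have hdVΨ : DifferentiableAt ℝ (fun ξ : EuclideanSpace ℝ (Fin 2) => (4 * Real.pi * gaussVortexProfile ξ / burgersPhi (‖ξ‖ ^ 2 / 4)) * Ψ ξ) ξ := (hVΨC1.differentiable one_ne_zero) ξ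
    have hdV : DifferentiableAt ℝ (fun ξ : EuclideanSpace ℝ (Fin 2) => (4 * Real.pi * gaussVortexProfile ξ / burgersPhi (‖ξ‖ ^ 2 / 4))) ξ := (hVC.differentiable (by simp)) ξ
    have hdΨ : DifferentiableAt ℝ Ψ ξ := (hΨC1.differentiable one_ne_zero) ξ
    rw [fderiv_fun_sub hdF hdVΨ, fderiv_fun_mul hdV hdΨ]
    have hn := norm_sub_le (fderiv ℝ F ξ) ((4 * Real.pi * gaussVortexProfile ξ / burgersPhi (‖ξ‖ ^ 2 / 4)) • fderiv ℝ Ψ ξ + Ψ ξ • fderiv ℝ (fun ξ : EuclideanSpace ℝ (Fin 2) => (4 * Real.pi * gaussVortexProfile ξ / burgersPhi (‖ξ‖ ^ 2 / 4))) ξ)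
    have hn2 := norm_add_le ((4 * Real.pi * gaussVortexProfile ξ / burgersPhi (‖ξ‖ ^ 2 / 4)) • fderiv ℝ Ψ ξ) (Ψ ξ • fderiv ℝ (fun ξ : EuclideanSpace ℝ (Fin 2) => (4 * Real.pi * gaussVortexProfile ξ / burgersPhi (‖ξ‖ ^ 2 / 4))) ξ)
    rw [norm_smul, norm_smul, Real.norm_eq_abs, Real.norm_eq_abs, abs_of_nonneg (repr_V_nonneg ξ)] at hn2
    have hV := repr_V_le ξ
    have hDV := repr_norm_fderiv_V_le ξ
    have hΨ := hΨbd ξ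
    have hDΨ := hΨD ξ
    have hlog := repr_one_add_log_le (norm_nonneg ξ)
    have hlog0 : 0 ≤ 1 + Real.log (1 + ‖ξ‖) := by
      have : 0 ≤ Real.log (1 + ‖ξ‖) := Real.log_nonneg (by linarith [norm_nonneg ξ]); linarith
    have habs := hK₄ ‖ξ‖ (norm_nonneg ξ)
    have hr : (1:ℝ) ≤ 1 + ‖ξ‖ := by linarith [norm_nonneg ξ]
    have hp2 : (1 + ‖ξ‖) ^ 2 ≤ (1 + ‖ξ‖) ^ 4 := pow_le_pow_right₀ hr (by norm_num)
    have e0 : 0 ≤ Real.exp (-(1 / 4) * ‖ξ‖ ^ 2) := (Real.exp_pos _).le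
    have t1 : (4 * Real.pi * gaussVortexProfile ξ / burgersPhi (‖ξ‖ ^ 2 / 4)) * ‖fderiv ℝ Ψ ξ‖ ≤ D * ((1 + ‖ξ‖) ^ 4 * Real.exp (-(1 / 4) * ‖ξ‖ ^ 2)) :=
      calc (4 * Real.pi * gaussVortexProfile ξ / burgersPhi (‖ξ‖ ^ 2 / 4)) * ‖fderiv ℝ Ψ ξ‖ ≤ ((1 + ‖ξ‖) ^ 2 * Real.exp (-(1 / 4) * ‖ξ‖ ^ 2)) * D :=
            mul_le_mul hV hDΨ (norm_nonneg _) (by positivity)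
        _ ≤ ((1 + ‖ξ‖) ^ 4 * Real.exp (-(1 / 4) * ‖ξ‖ ^ 2)) * D := by gcongr
        _ = _ := by ring
    have t2 : |Ψ ξ| * ‖fderiv ℝ (fun ξ : EuclideanSpace ℝ (Fin 2) => (4 * Real.pi * gaussVortexProfile ξ / burgersPhi (‖ξ‖ ^ 2 / 4))) ξ‖ ≤
        2 * A * ((1 + ‖ξ‖) ^ 4 * Real.exp (-(1 / 4) * ‖ξ‖ ^ 2)) :=
      calc |Ψ ξ| * ‖fderiv ℝ (fun ξ : EuclideanSpace ℝ (Fin 2) => (4 * Real.pi * gaussVortexProfile ξ / burgersPhi (‖ξ‖ ^ 2 / 4))) ξ‖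
          ≤ (A * (1 + Real.log (1 + ‖ξ‖))) * (2 * (1 + ‖ξ‖) ^ 3 * Real.exp (-(1 / 4) * ‖ξ‖ ^ 2)) :=
            mul_le_mul hΨ hDV (norm_nonneg _) (by positivity)
        _ ≤ (A * (1 + ‖ξ‖)) * (2 * (1 + ‖ξ‖) ^ 3 * Real.exp (-(1 / 4) * ‖ξ‖ ^ 2)) := by gcongr
        _ = _ := by ring
    have t3 : (D + 2 * A) * ((1 + ‖ξ‖) ^ 4 * Real.exp (-(1 / 4) * ‖ξ‖ ^ 2)) ≤
        (D + 2 * A) * (K₄ * Real.exp (-(1 / 8) * ‖ξ‖ ^ 2)) := mul_le_mul_of_nonneg_left habs (by positivity)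
    have e8 : 0 ≤ Real.exp (-(1 / 8) * ‖ξ‖ ^ 2) := (Real.exp_pos _).le
    have t4 : 0 ≤ B₁ * Real.exp (-(1 / 8) * ‖ξ‖ ^ 2) := by positivity
    calc ‖fderiv ℝ F ξ - ((4 * Real.pi * gaussVortexProfile ξ / burgersPhi (‖ξ‖ ^ 2 / 4)) • fderiv ℝ Ψ ξ + Ψ ξ • fderiv ℝ (fun ξ : EuclideanSpace ℝ (Fin 2) => (4 * Real.pi * gaussVortexProfile ξ / burgersPhi (‖ξ‖ ^ 2 / 4))) ξ)‖
        ≤ ‖fderiv ℝ F ξ‖ + ((4 * Real.pi * gaussVortexProfile ξ / burgersPhi (‖ξ‖ ^ 2 / 4)) * ‖fderiv ℝ Ψ ξ‖ + |Ψ ξ| * ‖fderiv ℝ (fun ξ : EuclideanSpace ℝ (Fin 2) => (4 * Real.pi * gaussVortexProfile ξ / burgersPhi (‖ξ‖ ^ 2 / 4))) ξ‖) :=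
          hn.trans (add_le_add le_rfl hn2)
      _ ≤ BF * Real.exp (-(1 / 8) * ‖ξ‖ ^ 2) + (D + 2 * A) * ((1 + ‖ξ‖) ^ 4 * Real.exp (-(1 / 4) * ‖ξ‖ ^ 2)) := by
          have := hF1 ξ; linarith
      _ ≤ BF * Real.exp (-(1 / 8) * ‖ξ‖ ^ 2) + (D + 2 * A) * (K₄ * Real.exp (-(1 / 8) * ‖ξ‖ ^ 2)) := by linarith
      _ ≤ (BF + B₁ + (D + 2 * A) * K₄) * Real.exp (-(1 / 8) * ‖ξ‖ ^ 2) := by nlinarith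

/-! ### The registered lemma -/

/-- **`C¹` representation of the stream function** (registered stub `cellStream_representation` of crux
stmt-AnomalousDissipation-3009). Hypotheses: the derivative-gain property of the logarithmic potential for bounded
measurable Gaussian-decaying densities (`logPotential_gain`); a `C¹` datum `F` with `|F|, ‖DF‖ ≤ B_F e^{−‖η‖²/8}`; a
measurable `h` whose potential `U = N∗(qh)` is measurable with `|U| ≤ K(1 + log(1+‖ξ‖))` and which solves
`h + qU = q N∗F` a.e. Conclusions for `Ψ := N∗F − U`: `Ψ ∈ C¹`; `Ψ = N ∗ (F − VΨ)` pointwise; `F − VΨ ∈ C¹` with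
`|·|, ‖D·‖ ≤ B₂ e^{−‖ξ‖²/8}`; `‖∇Ψ‖ ≤ M`, `|Ψ| ≤ M(1 + log(1+‖ξ‖))`. Proof: `qΨ = h` a.e. gives `U = N∗(VΨ)`
everywhere; `VΨ` is measurable with Gaussian bound, so the gain hypothesis applies. [folklore] -/
theorem cellStream_representation :
    (∀ (B : ℝ) (g : EuclideanSpace ℝ (Fin 2) → ℝ), Measurable g →
      (∀ η, |g η| ≤ B * Real.exp (-(1 / 8) * ‖η‖ ^ 2)) →
      ContDiff ℝ 1 (fun ξ : EuclideanSpace ℝ (Fin 2) => ∫ η, (2 * Real.pi)⁻¹ * Real.log ‖ξ - η‖ * g η) ∧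
      (∀ ξ : EuclideanSpace ℝ (Fin 2),
        Integrable (fun η : EuclideanSpace ℝ (Fin 2) => g η • ((2 * Real.pi * ‖ξ - η‖ ^ 2)⁻¹ • (ξ - η))) ∧
          gradient (fun ξ : EuclideanSpace ℝ (Fin 2) => ∫ η, (2 * Real.pi)⁻¹ * Real.log ‖ξ - η‖ * g η) ξ =
            ∫ η, g η • ((2 * Real.pi * ‖ξ - η‖ ^ 2)⁻¹ • (ξ - η))) ∧
      ∃ C : ℝ, ∀ ξ : EuclideanSpace ℝ (Fin 2),
        |∫ η, (2 * Real.pi)⁻¹ * Real.log ‖ξ - η‖ * g η| ≤ C * (1 + Real.log (1 + ‖ξ‖)) ∧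
        ‖gradient (fun ξ : EuclideanSpace ℝ (Fin 2) => ∫ η, (2 * Real.pi)⁻¹ * Real.log ‖ξ - η‖ * g η) ξ‖ ≤ C) →
    ∀ (BF : ℝ) (F : EuclideanSpace ℝ (Fin 2) → ℝ), ContDiff ℝ 1 F →
      (∀ η, |F η| ≤ BF * Real.exp (-(1 / 8) * ‖η‖ ^ 2)) →
      (∀ η, ‖fderiv ℝ F η‖ ≤ BF * Real.exp (-(1 / 8) * ‖η‖ ^ 2)) →
    ∀ (K : ℝ) (h : EuclideanSpace ℝ (Fin 2) → ℝ), Measurable h →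
      Measurable (fun ξ : EuclideanSpace ℝ (Fin 2) => ∫ η, (2 * Real.pi)⁻¹ * Real.log ‖ξ - η‖ * (Real.sqrt (4 * Real.pi * gaussVortexProfile η / burgersPhi (‖η‖ ^ 2 / 4)) * h η)) →
      (∀ ξ : EuclideanSpace ℝ (Fin 2), |∫ η, (2 * Real.pi)⁻¹ * Real.log ‖ξ - η‖ * (Real.sqrt (4 * Real.pi * gaussVortexProfile η / burgersPhi (‖η‖ ^ 2 / 4)) * h η)| ≤ K * (1 + Real.log (1 + ‖ξ‖))) →
      (∀ᵐ ξ : EuclideanSpace ℝ (Fin 2) ∂volume, h ξ + Real.sqrt (4 * Real.pi * gaussVortexProfile ξ / burgersPhi (‖ξ‖ ^ 2 / 4)) * (∫ η, (2 * Real.pi)⁻¹ * Real.log ‖ξ - η‖ * (Real.sqrt (4 * Real.pi * gaussVortexProfile η / burgersPhi (‖η‖ ^ 2 / 4)) * h η)) =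
        Real.sqrt (4 * Real.pi * gaussVortexProfile ξ / burgersPhi (‖ξ‖ ^ 2 / 4)) * ∫ η, (2 * Real.pi)⁻¹ * Real.log ‖ξ - η‖ * F η) →
      let Ψ : EuclideanSpace ℝ (Fin 2) → ℝ := fun ξ => (∫ η, (2 * Real.pi)⁻¹ * Real.log ‖ξ - η‖ * F η) - ∫ η, (2 * Real.pi)⁻¹ * Real.log ‖ξ - η‖ * (Real.sqrt (4 * Real.pi * gaussVortexProfile η / burgersPhi (‖η‖ ^ 2 / 4)) * h η)
      ContDiff ℝ 1 Ψ ∧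
      (∀ ξ, Ψ ξ = ∫ η, (2 * Real.pi)⁻¹ * Real.log ‖ξ - η‖ * (F η - (4 * Real.pi * gaussVortexProfile η / burgersPhi (‖η‖ ^ 2 / 4)) * Ψ η)) ∧
      (∃ B₂ : ℝ, ContDiff ℝ 1 (fun ξ => F ξ - (4 * Real.pi * gaussVortexProfile ξ / burgersPhi (‖ξ‖ ^ 2 / 4)) * Ψ ξ) ∧
        (∀ ξ, |F ξ - (4 * Real.pi * gaussVortexProfile ξ / burgersPhi (‖ξ‖ ^ 2 / 4)) * Ψ ξ| ≤ B₂ * Real.exp (-(1 / 8) * ‖ξ‖ ^ 2)) ∧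
        (∀ ξ, ‖fderiv ℝ (fun ξ => F ξ - (4 * Real.pi * gaussVortexProfile ξ / burgersPhi (‖ξ‖ ^ 2 / 4)) * Ψ ξ) ξ‖ ≤ B₂ * Real.exp (-(1 / 8) * ‖ξ‖ ^ 2))) ∧
      (∃ M : ℝ, ∀ ξ, ‖gradient Ψ ξ‖ ≤ M ∧ |Ψ ξ| ≤ M * (1 + Real.log (1 + ‖ξ‖))) := by
  intro hgain BF F hF hF0 hF1 K h hmeas hUmeas hUbd hae Ψ
  obtain ⟨-, -, hqsq, -, -, -, -⟩ := cellStream_sqrtPotential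
  obtain ⟨-, hVC, -, -, -⟩ := stub_cellSolvability_radialWeights
  -- the datum potential `N ∗ F`
  obtain ⟨hNF_C1, -, MF, -, hMF0, -, hNF_D⟩ := classInv_psi hF hF0 hF1
  obtain ⟨CF, hCF0, hNF_bd⟩ := abs_logPotential_le hF0
  have hK0 : 0 ≤ K := by
    have h0 := hUbd 0
    simp only [norm_zero, add_zero, Real.log_one, mul_one] at h0
    exact (abs_nonneg _).trans h0
  -- growth of `Ψ`
  have hΨbd : ∀ ξ, |Ψ ξ| ≤ (CF + K) * (1 + Real.log (1 + ‖ξ‖)) := by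
    intro ξ
    have h1 := hNF_bd ξ
    have h2 := hUbd ξ
    have h3 := abs_sub (∫ η, (2 * Real.pi)⁻¹ * Real.log ‖ξ - η‖ * F η) (∫ η, (2 * Real.pi)⁻¹ * Real.log ‖ξ - η‖ * (Real.sqrt (4 * Real.pi * gaussVortexProfile η / burgersPhi (‖η‖ ^ 2 / 4)) * h η))
    show |(∫ η, (2 * Real.pi)⁻¹ * Real.log ‖ξ - η‖ * F η) - ∫ η, (2 * Real.pi)⁻¹ * Real.log ‖ξ - η‖ * (Real.sqrt (4 * Real.pi * gaussVortexProfile η / burgersPhi (‖η‖ ^ 2 / 4)) * h η)| ≤ _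
    linarith
  -- the density `VΨ`: measurable with a Gaussian bound
  have hΨmeas : Measurable Ψ := hNF_C1.continuous.measurable.sub hUmeas
  have hg0meas : Measurable (fun ξ : EuclideanSpace ℝ (Fin 2) => (4 * Real.pi * gaussVortexProfile ξ / burgersPhi (‖ξ‖ ^ 2 / 4)) * Ψ ξ) :=
    (hVC.continuous.measurable).mul hΨmeas
  obtain ⟨K₃, hK₃0, hK₃⟩ := repr_absorb 3
  have hg0bd : ∀ η : EuclideanSpace ℝ (Fin 2), |(4 * Real.pi * gaussVortexProfile η / burgersPhi (‖η‖ ^ 2 / 4)) * Ψ η| ≤ (CF + K) * K₃ * Real.exp (-(1 / 8) * ‖η‖ ^ 2) := by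
    intro η
    have hV := repr_V_le η
    have hV0 := repr_V_nonneg η
    have hΨ := hΨbd η
    have hlog := repr_one_add_log_le (norm_nonneg η)
    have hlog0 : 0 ≤ 1 + Real.log (1 + ‖η‖) := by
      have : 0 ≤ Real.log (1 + ‖η‖) := Real.log_nonneg (by linarith [norm_nonneg η]); linarith
    have habs := hK₃ ‖η‖ (norm_nonneg η)
    rw [abs_mul, abs_of_nonneg hV0]
    calc (4 * Real.pi * gaussVortexProfile η / burgersPhi (‖η‖ ^ 2 / 4)) * |Ψ η|
        ≤ ((1 + ‖η‖) ^ 2 * Real.exp (-(1 / 4) * ‖η‖ ^ 2)) * ((CF + K) * (1 + Real.log (1 + ‖η‖))) :=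
          mul_le_mul hV hΨ (abs_nonneg _) (by positivity)
      _ ≤ ((1 + ‖η‖) ^ 2 * Real.exp (-(1 / 4) * ‖η‖ ^ 2)) * ((CF + K) * (1 + ‖η‖)) := by
          gcongr
      _ = (CF + K) * ((1 + ‖η‖) ^ 3 * Real.exp (-(1 / 4) * ‖η‖ ^ 2)) := by ring
      _ ≤ (CF + K) * (K₃ * Real.exp (-(1 / 8) * ‖η‖ ^ 2)) := mul_le_mul_of_nonneg_left habs (by positivity)
      _ = _ := by ring
  -- the gain hypothesis on `VΨ`
  obtain ⟨hU_C1, hUgrad, CU, hUbds⟩ := hgain ((CF + K) * K₃) (fun ξ => (4 * Real.pi * gaussVortexProfile ξ / burgersPhi (‖ξ‖ ^ 2 / 4)) * Ψ ξ) hg0meas hg0bd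
  -- `q h = V Ψ` a.e., hence `U = N ∗ (VΨ)` everywhere
  have hqΨ : ∀ᵐ η : EuclideanSpace ℝ (Fin 2) ∂volume, Real.sqrt (4 * Real.pi * gaussVortexProfile η / burgersPhi (‖η‖ ^ 2 / 4)) * h η = (4 * Real.pi * gaussVortexProfile η / burgersPhi (‖η‖ ^ 2 / 4)) * Ψ η := by
    filter_upwards [hae] with η hη
    have hh : h η = Real.sqrt (4 * Real.pi * gaussVortexProfile η / burgersPhi (‖η‖ ^ 2 / 4)) * Ψ η := by
      show h η = Real.sqrt (4 * Real.pi * gaussVortexProfile η / burgersPhi (‖η‖ ^ 2 / 4)) * ((∫ η', (2 * Real.pi)⁻¹ * Real.log ‖η - η'‖ * F η') - ∫ η', (2 * Real.pi)⁻¹ * Real.log ‖η - η'‖ * (Real.sqrt (4 * Real.pi * gaussVortexProfile η' / burgersPhi (‖η'‖ ^ 2 / 4)) * h η'))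
      rw [mul_sub]; linarith
    rw [hh, ← mul_assoc, ← pow_two, hqsq η]
  have hUeq : ∀ ξ : EuclideanSpace ℝ (Fin 2), (∫ η, (2 * Real.pi)⁻¹ * Real.log ‖ξ - η‖ * (Real.sqrt (4 * Real.pi * gaussVortexProfile η / burgersPhi (‖η‖ ^ 2 / 4)) * h η)) =
      ∫ η, (2 * Real.pi)⁻¹ * Real.log ‖ξ - η‖ * ((4 * Real.pi * gaussVortexProfile η / burgersPhi (‖η‖ ^ 2 / 4)) * Ψ η) := fun ξ =>
    integral_congr_ae (by filter_upwards [hqΨ] with η hη; rw [hη])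
  have hΨeq : Ψ = fun ξ => (∫ η, (2 * Real.pi)⁻¹ * Real.log ‖ξ - η‖ * F η) - ∫ η, (2 * Real.pi)⁻¹ * Real.log ‖ξ - η‖ * ((4 * Real.pi * gaussVortexProfile η / burgersPhi (‖η‖ ^ 2 / 4)) * Ψ η) :=
    funext fun ξ => by
      show (∫ η, (2 * Real.pi)⁻¹ * Real.log ‖ξ - η‖ * F η) - (∫ η, (2 * Real.pi)⁻¹ * Real.log ‖ξ - η‖ * (Real.sqrt (4 * Real.pi * gaussVortexProfile η / burgersPhi (‖η‖ ^ 2 / 4)) * h η)) = _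
      rw [hUeq ξ]
  have hΨC1 : ContDiff ℝ 1 Ψ := by rw [hΨeq]; exact hNF_C1.sub hU_C1
  -- the representation `Ψ = N ∗ (F − VΨ)`
  have hrep : ∀ ξ, Ψ ξ = ∫ η, (2 * Real.pi)⁻¹ * Real.log ‖ξ - η‖ * (F η - (4 * Real.pi * gaussVortexProfile η / burgersPhi (‖η‖ ^ 2 / 4)) * Ψ η) := by
    intro ξ
    have hiF := neutralBdd_integrable_logKernel_mul hF.continuous.measurable hF0 ξ
    have hig := neutralBdd_integrable_logKernel_mul hg0meas hg0bd ξ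
    have e : (fun η : EuclideanSpace ℝ (Fin 2) => (2 * Real.pi)⁻¹ * Real.log ‖ξ - η‖ * (F η - (4 * Real.pi * gaussVortexProfile η / burgersPhi (‖η‖ ^ 2 / 4)) * Ψ η)) =
        fun η => (2 * Real.pi)⁻¹ * Real.log ‖ξ - η‖ * F η - (2 * Real.pi)⁻¹ * Real.log ‖ξ - η‖ * ((4 * Real.pi * gaussVortexProfile η / burgersPhi (‖η‖ ^ 2 / 4)) * Ψ η) := funext fun η => mul_sub _ _ _
    rw [e, integral_sub hiF hig, ← hUeq ξ]
  -- gradient bound and growth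
  have hCU0 : 0 ≤ CU := le_trans (norm_nonneg _) (hUbds 0).2
  have key : ∀ (f : EuclideanSpace ℝ (Fin 2) → ℝ) (x : EuclideanSpace ℝ (Fin 2)), ‖gradient f x‖ = ‖fderiv ℝ f x‖ := fun f x => by
    rw [gradient, LinearIsometryEquiv.norm_map]
  have hΨD : ∀ ξ, ‖fderiv ℝ Ψ ξ‖ ≤ MF + CU := by
    intro ξ
    rw [hΨeq]
    have hd1 : DifferentiableAt ℝ (fun ξ : EuclideanSpace ℝ (Fin 2) => ∫ η, (2 * Real.pi)⁻¹ * Real.log ‖ξ - η‖ * F η) ξ := (hNF_C1.differentiable one_ne_zero) ξ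
    have hd2 : DifferentiableAt ℝ (fun ξ : EuclideanSpace ℝ (Fin 2) => ∫ η, (2 * Real.pi)⁻¹ * Real.log ‖ξ - η‖ * ((4 * Real.pi * gaussVortexProfile η / burgersPhi (‖η‖ ^ 2 / 4)) * Ψ η)) ξ :=
      (hU_C1.differentiable one_ne_zero) ξ
    rw [fderiv_fun_sub hd1 hd2]
    refine (norm_sub_le _ _).trans (add_le_add (hNF_D ξ) ?_)
    rw [← key]; exact (hUbds ξ).2
  refine ⟨hΨC1, hrep, ?_, ⟨MF + CU + (CF + K), fun ξ => ⟨?_, ?_⟩⟩⟩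
  · -- the `C¹` Gaussian class of `g = F − VΨ`
    have hA : 0 ≤ CF + K := by positivity
    have hB₁ : 0 ≤ (CF + K) * K₃ := by positivity
    have hD0 : 0 ≤ MF + CU := by positivity
    exact repr_gclass hF hF0 hF1 hΨC1 hA hD0 hB₁ hΨbd hΨD hg0bd
  · rw [key]; linarith [hΨD ξ]
  · have h1 := hΨbd ξ
    have hlog0 : 0 ≤ 1 + Real.log (1 + ‖ξ‖) := by
      have : 0 ≤ Real.log (1 + ‖ξ‖) := Real.log_nonneg (by linarith [norm_nonneg ξ]); linarith
    nlinarith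

end Summit.AnomalousDissipation.AnomalousDissipation.Theorems.MarginalStabilityChainStretchedVortexRows

end
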